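import Summits.QuantumFields.BalabanUV.T4Continuum.Support.SkeletonFillLawful
import Summits.QuantumFields.BalabanUV.T4Continuum.Support.SkeletonPrecompGrad
import Summits.QuantumFields.BalabanUV.T4Continuum.Support.BlockAverageLoopLog

/-!
# T⁴ programme, node NE3 — the kinematic refinement lemma, row NE3-S4c ↔ row S4e LINK (supply for the R1 assembly):
# the first-moment exponent of ANY lawful filling at a block corner IS the pre-compensation of its 1-skeleton datum,
# `Xfirst L W (L•z) κ = X0 L T z κ`; the shift `D` is a covariant curl (third order); `X₀(T) − X₀(U)` is third order

Cell `pub-balaban`, NE3 (node U1b) formalisation swarm, unit `b2b-balaban-t4-ne3-formalise-leaf-01` (LEAF PROVER 01),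
row **S4c** of `t4/formal/NE3/LEAVES.md`, supply for row R1-asm (leaf-09, owner ruling «NE3-R1-ASSEMBLY»): the
assembly's residual after row S4e's mismatch law (`BlockAverageLoopLog.mismatch_of_regular`, leaf-08) is
`‖W(Γ_c) − exp(−Xfirst L W (L•z) κ)·U(z,κ)‖` with `W(Γ_c) = T(z,κ) = exp(−X0 L U z κ)·U(z,κ)` (`hol_seg_lawful`,
`precomp`); it is third order once (i) `Xfirst` of the filling is identified and (ii) `X₀(T) − X₀(U)` is bounded:
* **`plaqLog_lawful_corner`** ∕ **`Xfirst_lawful`**: for `W` lawful on the 2-skeleton of the datum `T` (`LawfulFill L T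
  (rootH L T) W`, `SkeletonDatum L P a T`): `plaqLog W κ m (L•z) = rootCoeff L • mlog T(∂p_{mκ}(z))` for every `m`
  (corner plaquettes ARE the roots, both orientations; `m = κ` gives `0 = 0`), hence
  `Xfirst L W ((L:ℤ) • z) κ = X0 L T z κ` (`(L(L−1)/2)·L^{−2} = (L−1)/(2L)`);
* **`norm_fluxShift_le_firstOrder`**: `‖fluxShift L U z κ ν‖ ≤ 2·c_X + 4·a·x₀`, `c_X = ((L−1)/(2L))(d−1)g` — the shift of
  file 6 is `[Ad_Q X₀(z+e_ν,κ) − X₀(z,κ)] − [Ad_{U(z,κ)}X₀(z+e_κ,ν) − Ad_{U(∂p)}X₀(z,ν)]`, two covariant gradients of `X₀` up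
  to conjugations by the plaquette (sharpens file 6's zeroth-order `4x₀`);
* **`norm_flux_precomp_sub_flux_le'`** (value level: `‖flux T p − flux U p‖ ≤ 2c_X + 4ax₀ + 156x₀² + 24x₀a`) and
  **`norm_X0_precomp_sub_X0_le`**: `‖X0 L (precomp L U) z κ − X0 L U z κ‖ ≤ ((L−1)/(2L))·(d−1)·(2c_X + 4ax₀ + 156x₀² + 24x₀a)`
  under `(d−1)a ≤ 1/32`, `(8d−7)a ≤ 1/4` (a parallel route to leaf-09's `PrecompensatedPlaquette` (PP3); either may be
  used by the assembly).

HONEST FRAMING.  Supply lemmas (elementary matrix analysis); no estimate of the series, no minimiser; no conditional of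
the cell (`BetaPertH`, (B), (B^μ)) is used or hidden; nothing bears on infinite volume, a mass gap, or the Clay problem;
**NE3 is NOT proved**, `SmoothRefine` ∕ `ApproxRefine` are NOT proved here.  Finite T⁴ rung (B)+1.  ABSOLUTE RULE kept:
no printed sentence is a hypothesis of any declaration; no `sorry`, axioms ⊆ {propext, Classical.choice, Quot.sound}.
PLACEMENT (human rule 2026-08-19): cell work under `Summits/QuantumFields/BalabanUV/`; imports files 3b∕7 of this row
and leaf-08's accepted `Support.BlockAverageLoopLog` BY NAME (`Xfirst`, `plaqLog`); moves nothing.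
-/

set_option autoImplicit false

open scoped BigOperators Matrix Matrix.Norms.L2Operator
open NormedSpace Finset

namespace Summit.QuantumFields.BalabanUV.T4Continuum.SkeletonLoopLogLink

open Literature.MathematicalPhysics.QuantumFieldTheory.Balaban1983to89
open B7Prop1Explicit B7Prop2Explicit B7Prop1Local MatrixLog
open T4AveragingDeficitWall hiding Site Plane Plaq Bond
open T4AveragingDeficitWallBoundary (IsPeriodicCfg)
open AveragingDeficitTransport (norm_Ad_of_unitary mem_U1_of_unitary)
open AveragingDeficitNearIdentity (Ad_one Ad_real_smul Ad_add Ad_neg Ad_sum norm_Ad_sub_le)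
open T4AveragingDeficitNonAbelian (Ad_mul Ad_sub)
open SkeletonLattice SkeletonFill SkeletonFillUnitary SkeletonFillLawful SkeletonPrecomp SkeletonPrecompTools
  SkeletonPrecompFlux SkeletonPrecompGrad
open BlockAverageLoopLogCore (plaqLog Xfirst)

noncomputable section

variable {d : ℕ} {n : Type*} [Fintype n] [DecidableEq n]

/-! ## §1 The first-moment exponent of a lawful filling is the pre-compensation of its datum -/

section Identification

variable {L : ℕ} {P : ℤ} {a : ℝ} {T W : B7Prop1Explicit.Site d → Fin d → (Matrix n n ℂ)ˣ}

/-- The loop-oriented logarithm of a 2-cell plaquette of `T` is `−` that of the reversed word, both orientations, under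
the datum hypotheses. [folklore] -/
theorem mlog_hol_swap_datum (hD : SkeletonDatum L P a T) (z : B7Prop1Explicit.Site d) (κ m : Fin d) :
    mlog ((hol T z (plaqWord m κ) : (Matrix n n ℂ)ˣ) : Matrix n n ℂ)
      = -mlog ((hol T z (plaqWord κ m) : (Matrix n n ℂ)ˣ) : Matrix n n ℂ) := by
  rw [SkeletonPrecompTools.hol_plaqWord_swap]
  exact mlog_inv_eq_neg (hD.small_all z κ m)

/-- **CORNER PLAQUETTE LOGARITHMS OF A LAWFUL FILLING**: `plaqLog W κ m (L•z) = L^{−2} • mlog T(∂p_{mκ}(z))` for every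
`m` (for `m < κ` the corner plaquette is `rootH L T z m κ`; for `κ < m` it is `(rootH L T z κ m)⁻¹ = exp(−rootLog)`; for
`m = κ` both sides vanish). [folklore] -/
theorem plaqLog_lawful_corner [Nonempty n] (hW : LawfulFill L T (rootH L T) W) (hD : SkeletonDatum L P a T)
    (z : B7Prop1Explicit.Site d) (κ m : Fin d) :
    plaqLog W κ m ((L : ℤ) • z) = rootCoeff L • mlog ((hol T z (plaqWord m κ) : (Matrix n n ℂ)ˣ) : Matrix n n ℂ) := by
  have hL := hD.one_le
  rcases lt_trichotomy m κ with h | h | h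
  · -- `m < κ`: the corner plaquette in the `Plane` orientation
    have hx : (L : ℤ) • z = (L : ℤ) • z + off2 m κ 0 0 := by simp [off2]
    rw [BlockAverageLoopLog.plaqLog_eq_flux W h, hx, flux_lawful hW hD h z hL hL, rootLog]
  · subst h
    rw [BlockAverageLoopLog.plaqLog_self, hol_plaqWord_self, Units.val_one, mlog_one]
    simp
  · -- `κ < m`: the reversed corner plaquette
    have hx : (L : ℤ) • z = (L : ℤ) • z + off2 κ m 0 0 := by simp [off2]
    unfold plaqLog
    rw [SkeletonPrecompTools.hol_plaqWord_swap, hx, hol_plaq_lawful hW hD h z hL hL, rootH, val_inv_expUnit,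
      val_expUnit, mlog_hol_swap_datum hD z κ m, smul_neg, ← rootLog]
    refine B7BlockAvgLog.mlog_exp ?_
    rw [norm_neg]
    have ha0 := hD.nonneg (ne_of_lt h)
    have hY := norm_rootLog_le (L := L) T z κ m (hD.small z κ m (ne_of_lt h)) (by linarith [hD.le_quarter])
    have hc := rootCoeff_le_one hL
    have : rootCoeff L * (2 * a) ≤ 1 / 2 := by nlinarith [hD.le_quarter, rootCoeff_nonneg L]
    linarith [Real.log_two_gt_d9]

omit [Fintype n] [DecidableEq n] in
/-- `(L(L−1)/2) · L^{−2} = (L−1)/(2L)`. [folklore] -/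
theorem firstMoment_mul_rootCoeff {L : ℕ} (hL : 1 ≤ L) :
    ((L : ℝ) * ((L : ℝ) - 1) / 2) * rootCoeff L = precompCoeff L := by
  have hL' : (L : ℝ) ≠ 0 := by exact_mod_cast (by omega : L ≠ 0)
  unfold rootCoeff precompCoeff
  field_simp

/-- **THE IDENTIFICATION `Xfirst(W) = X₀(T)`**: at every block corner the first-moment exponent (row S4e) of a lawful
filling of the datum `T` equals the pre-compensation functional (row S4c) OF THE DATUM. [folklore] -/
theorem Xfirst_lawful [Nonempty n] (hW : LawfulFill L T (rootH L T) W) (hD : SkeletonDatum L P a T)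
    (z : B7Prop1Explicit.Site d) (κ : Fin d) :
    Xfirst L W ((L : ℤ) • z) κ = X0 L T z κ := by
  unfold Xfirst X0
  simp_rw [plaqLog_lawful_corner hW hD z κ]
  rw [← smul_sum, smul_smul, firstMoment_mul_rootCoeff hD.one_le,
    sum_erase univ (f := fun m => mlog ((hol T z (plaqWord m κ) : (Matrix n n ℂ)ˣ) : Matrix n n ℂ))
      (by rw [hol_plaqWord_self, Units.val_one, mlog_one])]

/-- Consequence for the assembly's residual: with `W(Γ_c) = T(z,κ) = exp(−X₀(U)(z,κ))·U(z,κ)` and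
`Xfirst(W)(L•z,κ) = X₀(T)(z,κ)`, the residual is `exp(−X₀(U))·U − exp(−X₀(T))·U`. [folklore] -/
theorem hol_seg_sub_residual [Nonempty n] {U : B7Prop1Explicit.Site d → Fin d → (Matrix n n ℂ)ˣ}
    (hW : LawfulFill L (precomp L U) (rootH L (precomp L U)) W) (hD : SkeletonDatum L P a (precomp L U))
    (z : B7Prop1Explicit.Site d) (κ : Fin d) :
    ((hol W ((L : ℤ) • z) (seg κ L) : (Matrix n n ℂ)ˣ) : Matrix n n ℂ)
        - exp (-Xfirst L W ((L : ℤ) • z) κ) * (U z κ : Matrix n n ℂ)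
      = (exp (-X0 L U z κ) - exp (-X0 L (precomp L U) z κ)) * (U z κ : Matrix n n ℂ) := by
  rw [hol_seg_lawful hW hD.one_le, Xfirst_lawful hW hD, sub_mul]
  simp [precomp]

end Identification

/-! ## §2 The shift is a covariant curl: first-order bound, and `X₀(T) − X₀(U)` -/

section Shift

variable {L : ℕ} {U : B7Prop1Explicit.Site d → Fin d → (Matrix n n ℂ)ˣ} {a g x₀ : ℝ}

/-- `Q = U(∂p)·U(z,ν)`: the three-sided transporter is the plaquette holonomy times the fourth side. [folklore] -/
theorem threeSides_eq_plaq_mul (U : B7Prop1Explicit.Site d → Fin d → (Matrix n n ℂ)ˣ) (z : B7Prop1Explicit.Site d)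
    (κ ν : Fin d) : threeSides U z κ ν = hol U z (plaqWord κ ν) * U z ν := by
  rw [threeSides, hol_plaqWord_eq]; group

/-- **THE SHIFT IS A COVARIANT CURL**: `‖D‖ ≤ 2·c_X + 4·a·x₀` where `c_X = ((L−1)/(2L))(d−1)g` bounds the covariant
gradient of `X₀` (`norm_covGradX0_le`) and `x₀ ≥ ‖X₀‖`. [folklore] -/
theorem norm_fluxShift_le_firstOrder [Nonempty n] (hL : 1 ≤ L) (hU : IsUnitaryCfg U) (hs : SmallField U a)
    (ha0 : 0 ≤ a) (ha : a ≤ 1 / 4)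
    (hg : ∀ (z : B7Prop1Explicit.Site d) (μ : Fin d) (π : T4AveragingDeficitWall.Plane d),
      ‖covGrad U (flux U) z μ π‖ ≤ g)
    (hX : ∀ z κ, ‖X0 L U z κ‖ ≤ x₀) (z : B7Prop1Explicit.Site d) (κ ν : Fin d) :
    ‖fluxShift L U z κ ν‖ ≤ 2 * (precompCoeff L * (((d : ℝ) - 1) * g)) + 4 * a * x₀ := by
  set cX : ℝ := precompCoeff L * (((d : ℝ) - 1) * g)
  have hP : hol U z (plaqWord κ ν) ∈ unitaryUnits (Matrix n n ℂ) := hol_mem_of hU _ _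
  have hPa : ‖((hol U z (plaqWord κ ν) : (Matrix n n ℂ)ˣ) : Matrix n n ℂ) - 1‖ ≤ a := norm_plaq_sub_one_le hs ha0 z κ ν
  have G1 := norm_covGradX0_le hL hs ha hg z ν κ
  have G2 := norm_covGradX0_le hL hs ha hg z κ ν
  -- first bracket: `Ad_Q X₀(z+e_ν,κ) − X₀(z,κ) = (Ad_P X₀(z,κ) − X₀(z,κ)) + Ad_P (covGradX0 z ν κ)`
  have e1 : Ad (threeSides U z κ ν) (X0 L U (z + e ν) κ) - X0 L U z κ
      = (Ad (hol U z (plaqWord κ ν)) (X0 L U z κ) - X0 L U z κ) + Ad (hol U z (plaqWord κ ν)) (covGradX0 L U z ν κ) := by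
    rw [threeSides_eq_plaq_mul, Ad_mul, covGradX0, Ad_sub]; abel
  have b1 : ‖Ad (threeSides U z κ ν) (X0 L U (z + e ν) κ) - X0 L U z κ‖ ≤ 2 * a * x₀ + cX := by
    rw [e1]
    have hm := mul_le_mul hPa (hX z κ) (norm_nonneg _) ha0
    refine (norm_add_le _ _).trans (add_le_add ((norm_Ad_sub_le hP _).trans (by nlinarith [hm])) ?_)
    rw [norm_Ad_of_unitary hP]; exact G1
  -- second bracket: `Ad_{U(z,κ)} X₀(z+e_κ,ν) − Ad_P X₀(z,ν) = covGradX0 z κ ν − (Ad_P X₀(z,ν) − X₀(z,ν))`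
  have e2 : Ad (U z κ) (X0 L U (z + e κ) ν) - Ad (hol U z (plaqWord κ ν)) (X0 L U z ν)
      = covGradX0 L U z κ ν - (Ad (hol U z (plaqWord κ ν)) (X0 L U z ν) - X0 L U z ν) := by
    rw [covGradX0]; abel
  have b2 : ‖Ad (U z κ) (X0 L U (z + e κ) ν) - Ad (hol U z (plaqWord κ ν)) (X0 L U z ν)‖ ≤ cX + 2 * a * x₀ := by
    rw [e2]
    have hm := mul_le_mul hPa (hX z ν) (norm_nonneg _) ha0
    exact (norm_sub_le _ _).trans (add_le_add G2 ((norm_Ad_sub_le hP _).trans (by nlinarith [hm])))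
  have e : fluxShift L U z κ ν = (Ad (threeSides U z κ ν) (X0 L U (z + e ν) κ) - X0 L U z κ)
      - (Ad (U z κ) (X0 L U (z + e κ) ν) - Ad (hol U z (plaqWord κ ν)) (X0 L U z ν)) := by
    rw [fluxShift]; abel
  rw [e]
  refine (norm_sub_le _ _).trans ?_
  linarith

/-- **VALUE-LEVEL TRANSPORT OF THE FLUX** (parallel to leaf-09's (PP3)): for `κ < ν`,
`‖flux T p − flux U p‖ ≤ 2c_X + 4a·x₀ + 156x₀² + 24x₀·a` (`x₀ ≤ 1/32`, `a ≤ 1/4`). [folklore] -/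
theorem norm_flux_precomp_sub_flux_le' [Nonempty n] (hL : 1 ≤ L) (hU : IsUnitaryCfg U) (hs : SmallField U a)
    (ha0 : 0 ≤ a) (ha : a ≤ 1 / 4)
    (hg : ∀ (z : B7Prop1Explicit.Site d) (μ : Fin d) (π : T4AveragingDeficitWall.Plane d),
      ‖covGrad U (flux U) z μ π‖ ≤ g)
    (hX : ∀ z κ, ‖X0 L U z κ‖ ≤ x₀) (hx₀ : x₀ ≤ 1 / 32) {κ ν : Fin d} (hκν : κ < ν) (z : B7Prop1Explicit.Site d) :
    ‖flux (precomp L U) (z, ⟨(κ, ν), hκν⟩) - flux U (z, ⟨(κ, ν), hκν⟩)‖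
      ≤ 2 * (precompCoeff L * (((d : ℝ) - 1) * g)) + 4 * a * x₀ + (156 * x₀ ^ 2 + 24 * x₀ * a) := by
  have h1 := norm_flux_precomp_sub_le hU hs ha hX hx₀ hκν z
  have h2 := norm_fluxShift_le_firstOrder hL hU hs ha0 ha hg hX z κ ν
  have e : flux (precomp L U) (z, ⟨(κ, ν), hκν⟩) - flux U (z, ⟨(κ, ν), hκν⟩)
      = (flux (precomp L U) (z, ⟨(κ, ν), hκν⟩) - flux U (z, ⟨(κ, ν), hκν⟩) - fluxShift L U z κ ν)
        + fluxShift L U z κ ν := by abel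
  rw [e]
  refine (norm_add_le _ _).trans ?_
  linarith

/-- The same for the loop-oriented logarithms `mlog ·(∂p_{mκ})`, any `m ≠ κ` (both orientations). [folklore] -/
theorem norm_mlog_precomp_sub_mlog_le [Nonempty n] (hL : 1 ≤ L) (hU : IsUnitaryCfg U) (hs : SmallField U a)
    (ha0 : 0 ≤ a)
    (hg : ∀ (z : B7Prop1Explicit.Site d) (μ : Fin d) (π : T4AveragingDeficitWall.Plane d),
      ‖covGrad U (flux U) z μ π‖ ≤ g)
    (hX : ∀ z κ, ‖X0 L U z κ‖ ≤ x₀) (hx₀ : x₀ ≤ 1 / 32) (hdT : (8 * (d : ℝ) - 7) * a ≤ 1 / 4)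
    (z : B7Prop1Explicit.Site d) {m κ : Fin d} (hmκ : m ≠ κ) :
    ‖mlog ((hol (precomp L U) z (plaqWord m κ) : (Matrix n n ℂ)ˣ) : Matrix n n ℂ)
        - mlog ((hol U z (plaqWord m κ) : (Matrix n n ℂ)ˣ) : Matrix n n ℂ)‖
      ≤ 2 * (precompCoeff L * (((d : ℝ) - 1) * g)) + 4 * a * x₀ + (156 * x₀ ^ 2 + 24 * x₀ * a) := by
  have hd1 : (1 : ℝ) ≤ d := by exact_mod_cast (show 1 ≤ d from κ.pos)
  have ha : a ≤ 1 / 4 := by nlinarith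
  have hda1 : ((d : ℝ) - 1) * a ≤ 1 := by nlinarith
  have hTs : SmallField (precomp L U) ((8 * (d : ℝ) - 7) * a) := smallField_precomp hL hU hs ha hda1
  rcases lt_or_gt_of_ne hmκ with h | h
  · exact norm_flux_precomp_sub_flux_le' hL hU hs ha0 ha hg hX hx₀ h z
  · rw [SkeletonPrecompTools.mlog_hol_plaqWord_swap hTs hdT z (ne_of_lt h),
      SkeletonPrecompTools.mlog_hol_plaqWord_swap hs ha z (ne_of_lt h),
      show ∀ A B : Matrix n n ℂ, -A - -B = -(A - B) from fun A B => by abel, norm_neg]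
    exact norm_flux_precomp_sub_flux_le' hL hU hs ha0 ha hg hX hx₀ h z

/-- **`X₀(T) − X₀(U)` IS THIRD ORDER**: `‖X0 L (precomp L U) z κ − X0 L U z κ‖ ≤ ((L−1)/(2L))·(d−1)·(2c_X + 4ax₀ + 156x₀²
+ 24x₀a)`. [folklore] -/
theorem norm_X0_precomp_sub_X0_le [Nonempty n] (hL : 1 ≤ L) (hU : IsUnitaryCfg U) (hs : SmallField U a)
    (ha0 : 0 ≤ a)
    (hg : ∀ (z : B7Prop1Explicit.Site d) (μ : Fin d) (π : T4AveragingDeficitWall.Plane d),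
      ‖covGrad U (flux U) z μ π‖ ≤ g)
    (hX : ∀ z κ, ‖X0 L U z κ‖ ≤ x₀) (hx₀ : x₀ ≤ 1 / 32) (hdT : (8 * (d : ℝ) - 7) * a ≤ 1 / 4)
    (z : B7Prop1Explicit.Site d) (κ : Fin d) :
    ‖X0 L (precomp L U) z κ - X0 L U z κ‖
      ≤ precompCoeff L * (((d : ℝ) - 1)
          * (2 * (precompCoeff L * (((d : ℝ) - 1) * g)) + 4 * a * x₀ + (156 * x₀ ^ 2 + 24 * x₀ * a))) := by
  unfold X0
  rw [← smul_sub, ← sum_sub_distrib, norm_smul, Real.norm_of_nonneg (precompCoeff_nonneg hL)]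
  refine mul_le_mul_of_nonneg_left ?_ (precompCoeff_nonneg hL)
  refine (norm_sum_le _ _).trans ?_
  have hcard : ((univ.erase κ).card : ℝ) = (d : ℝ) - 1 := by
    rw [card_erase_of_mem (mem_univ κ), card_univ, Fintype.card_fin, Nat.cast_sub κ.pos, Nat.cast_one]
  calc ∑ m ∈ univ.erase κ, ‖mlog ((hol (precomp L U) z (plaqWord m κ) : (Matrix n n ℂ)ˣ) : Matrix n n ℂ)
          - mlog ((hol U z (plaqWord m κ) : (Matrix n n ℂ)ˣ) : Matrix n n ℂ)‖
      ≤ ∑ _m ∈ univ.erase κ, (2 * (precompCoeff L * (((d : ℝ) - 1) * g)) + 4 * a * x₀ + (156 * x₀ ^ 2 + 24 * x₀ * a)) :=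
        sum_le_sum fun m hm => norm_mlog_precomp_sub_mlog_le hL hU hs ha0 hg hX hx₀ hdT z (mem_erase.mp hm).1
    _ = _ := by rw [sum_const, nsmul_eq_mul, hcard]

end Shift

end

end Summit.QuantumFields.BalabanUV.T4Continuum.SkeletonLoopLogLink
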